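import Summits.BirchSwinnertonDyer.BirchSwinnertonDyer.Theses.QuadraticBranchSignedControl
import Summits.BirchSwinnertonDyer.Rank1Residual.Additive.QuadraticTowerRestrict
import Summits.BirchSwinnertonDyer.Rank1Residual.Additive.BaseChangeSubgroupH1
import HarnessLib

/-!
# Route `QuadraticBranchSignedControl` (rung K8, cell `bsd-potss`), crux `EtaTransportSigned`
# (item stmt-BirchSwinnertonDyer-19115): the open image equality `hMap` (local-conditions half of
# ctrl's (i-c)) REDUCED to the LAYERS — `Θ_n(Sel⁺(V_F/F_n)) = Sel⁺(V/Fℚ_n)` for every `n`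

WHAT. `…EtaTransportSelmerComparisonOfMap.lean` reduces the plus stub's last frame to
`hMap : Θ(Sel⁺(V_F/F_∞^{κF})) = Sel⁺(V/Fℚ_∞)`, `Θ = subgroupH1Iso ∘ res` at the top of the towers.
Both sides are UNIONS over the layers (`Sel⁺(·/·_∞) := ⋃_n im Sel⁺(·/·_n)`, Kobayashi Def. 1.1 /
Def. 2.1), and ctrl's base-change isomorphisms commute with restriction (`subgroupH1Iso_resOfLe`);
so `hMap` FOLLOWS from the layer-by-layer statement `hLayer`: for every `n`,
`Θ_n(Kobayashi2003.signedSelmerLayer (V.baseChange F) κF 1 n) = towerSignedSelmerLayer V κ F ℚ_[p] 1 n`,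
`Θ_n := subgroupH1Iso (at U_n = towerSubgroup κ F n) ∘ res` (`κF⁻¹(pⁿℤ_p) = res⁻¹(U_n)`, ctrl's
`layerSubgroup_restrictGal`). What then remains is, at each FINITE layer `F_n = Fℚ_n`, the comparison
of Kobayashi's Def. 1.1 conditions for `V_F` (classical Selmer conditions at the places of `F_n`;
plus condition at `𝔭 ∣ p` over `F_𝔭·F_n`) with cc-typer-6's Def. 2.1-style conditions for `V`
(`selmerGroupOver p U_n`; plus condition at `ℚ_[p]` over `ℚ_p·Fℚ_n`).

HONEST FRAMING (cell `bsd-potss`, run/shared/lean/pub/bsd-potss/; FULL-BSD rank ≤ 1 programme):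
TOOL THEOREM ONLY — no definition, no named Literature fact, no `sorry`, axioms standard.
CONDITIONAL on the displayed frame `hLayer` (WANTED); closes nothing; nothing is booked;
`BSD(W, p)` is claimed for no pair. Seat `bsd-potss-k8q-c3` (prover), g0.

References: [Kobayashi2003] Def. 1.1 (p. 2), Def. 2.1 (p. 5) (`Sel^±(E/K_∞) := lim→ Sel^±(E/K_n)`);
[SerreGaloisCohomology1997] I.§2.4 (restriction is functorial); [GreenbergLNM1716] §3.
-/

set_option autoImplicit false
set_option linter.dupNamespace false

noncomputable section

open scoped Classical

open Field WeierstrassCurve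
open Literature.NumberTheory.EllipticCurves
open Literature.NumberTheory.GaloisRepresentations
open Summit.BirchSwinnertonDyer.Rank1Residual.Additive

namespace Summit.BirchSwinnertonDyer.BirchSwinnertonDyer.Theorems

/-- **`hMap` from the layer-by-layer image equalities `hLayer`.** With
`Θ = subgroupH1Iso_{U_∞} ∘ res` and `Θ_n = subgroupH1Iso_{U_n} ∘ res`:
`Θ ∘ (F-side restriction F_n ↝ F_∞) = (ℚ-side restriction U_∞ ≤ U_n) ∘ Θ_n` (`resOfLe_comp`,
`subgroupH1Iso_resOfLe`), so `Θ(⋃_n im Sel⁺(V_F/F_n)) = ⋃_n im Θ_n(Sel⁺(V_F/F_n)) = ⋃_n im Sel⁺(V/Fℚ_n)`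
(`AddSubgroup.map_iSup`, `map_map`). The conclusion is the hypothesis `hMap` of
`selmerComparison_of_map_eq` VERBATIM. CONDITIONAL on `hLayer`.
[cite: Kobayashi2003, Def. 1.1 (p. 2), Def. 2.1 (p. 5)] [cite: SerreGaloisCohomology1997, I.§2.4] -/
theorem selmerMap_of_layerMaps
    (hLayer : ∀ (p : ℕ) [Fact p.Prime], 5 ≤ p →
      ∀ (V : WeierstrassCurve ℚ) [V.IsElliptic] [V.IsGloballyMinimal],
        V.HasGoodReductionAtPrime p → V.frobeniusTrace p = 0 →
      ∀ (κ : ZpExtension ℚ p), κ.IsCyclotomic →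
      ∀ (F : Type) [Field F] [NumberField F] [(galRange (K := ℚ) F).Normal] (θF : F),
        Module.finrank ℚ F = 2 → θF ∉ Set.range (algebraMap ℚ F) →
        θF ^ 2 = algebraMap ℚ F ((-1) ^ (p / 2) * p) →
      ∀ (hκ₀ : ∀ x, ∃ g ∈ galRange (K := ℚ) F, κ g = x) (n : ℕ),
        (Kobayashi2003.signedSelmerLayer (V.baseChange F) (BaseChange.restrictGal F κ hκ₀) 1 n).map
          ((BaseChange.subgroupH1Iso F V p (towerSubgroup_le_galRange κ F n)).toAddMonoidHom.comp
            ((V.baseChange F).resOfLe p (BaseChange.layerSubgroup_restrictGal F κ hκ₀ n).ge)) =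
          towerSignedSelmerLayer V κ F ℚ_[p] 1 n) :
    ∀ (p : ℕ) [Fact p.Prime], 5 ≤ p →
      ∀ (V : WeierstrassCurve ℚ) [V.IsElliptic] [V.IsGloballyMinimal],
        V.HasGoodReductionAtPrime p → V.frobeniusTrace p = 0 →
      ∀ (κ : ZpExtension ℚ p), κ.IsCyclotomic →
      ∀ (F : Type) [Field F] [NumberField F] [(galRange (K := ℚ) F).Normal] (θF : F),
        Module.finrank ℚ F = 2 → θF ∉ Set.range (algebraMap ℚ F) →
        θF ^ 2 = algebraMap ℚ F ((-1) ^ (p / 2) * p) →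
      ∀ (hκ₀ : ∀ x, ∃ g ∈ galRange (K := ℚ) F, κ g = x),
        (Kobayashi2003.signedSelmerInfty (V.baseChange F) (BaseChange.restrictGal F κ hκ₀) 1).map
          ((BaseChange.subgroupH1Iso F V p
              ((towerTopSubgroup_le κ F 0).trans (towerSubgroup_le_galRange κ F 0))).toAddMonoidHom.comp
            ((V.baseChange F).resOfLe p (BaseChange.kerSubgroup_restrictGal F κ hκ₀).ge)) =
          towerSignedSelmerInfty V κ F ℚ_[p] 1 := by
  intro p _ hp5 V _ _ hgood hap κ hκ F _ _ _ θF h2 hθF hcF hκ₀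
  set κF := BaseChange.restrictGal F κ hκ₀ with hκF
  have hUtop : towerTopSubgroup κ F ≤ galRange (K := ℚ) F :=
    (towerTopSubgroup_le κ F 0).trans (towerSubgroup_le_galRange κ F 0)
  -- the infinite-level map and the layer maps
  set Θ : (V.baseChange F).subgroupH1 p κF.kerSubgroup →+ V.subgroupH1 p (towerTopSubgroup κ F) :=
    (BaseChange.subgroupH1Iso F V p hUtop).toAddMonoidHom.comp
      ((V.baseChange F).resOfLe p (BaseChange.kerSubgroup_restrictGal F κ hκ₀).ge) with hΘ
  have key : ∀ n : ℕ, Θ.comp ((V.baseChange F).layerToInfty κF n) =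
      (V.resOfLe p (towerTopSubgroup_le κ F n)).comp
        ((BaseChange.subgroupH1Iso F V p (towerSubgroup_le_galRange κ F n)).toAddMonoidHom.comp
          ((V.baseChange F).resOfLe p (BaseChange.layerSubgroup_restrictGal F κ hκ₀ n).ge)) := by
    intro n
    ext x
    change BaseChange.subgroupH1Iso F V p hUtop
        ((V.baseChange F).resOfLe p (BaseChange.kerSubgroup_restrictGal F κ hκ₀).ge
          ((V.baseChange F).resOfLe p (κF.kerSubgroup_le_layerSubgroup n) x)) =
      V.resOfLe p (towerTopSubgroup_le κ F n) (BaseChange.subgroupH1Iso F V p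
        (towerSubgroup_le_galRange κ F n)
          ((V.baseChange F).resOfLe p (BaseChange.layerSubgroup_restrictGal F κ hκ₀ n).ge x))
    rw [← BaseChange.subgroupH1Iso_resOfLe F V p (towerSubgroup_le_galRange κ F n)
      (towerTopSubgroup_le κ F n), ← AddMonoidHom.comp_apply ((V.baseChange F).resOfLe p _),
      (V.baseChange F).resOfLe_comp_holds p, ← AddMonoidHom.comp_apply ((V.baseChange F).resOfLe p _),
      (V.baseChange F).resOfLe_comp_holds p]
  -- unions over the layers
  change (⨆ n : ℕ, (Kobayashi2003.signedSelmerLayer (V.baseChange F) κF 1 n).map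
      ((V.baseChange F).layerToInfty κF n)).map Θ =
    ⨆ n : ℕ, (towerSignedSelmerLayer V κ F ℚ_[p] 1 n).map (V.resOfLe p (towerTopSubgroup_le κ F n))
  rw [AddSubgroup.map_iSup]
  refine iSup_congr fun n => ?_
  rw [AddSubgroup.map_map, key n, ← AddSubgroup.map_map, hLayer p hp5 V hgood hap κ hκ F θF h2 hθF hcF hκ₀ n]

end Summit.BirchSwinnertonDyer.BirchSwinnertonDyer.Theorems

end
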